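import Summits.SmoothPoincare4.SmoothPoincare4.Theorems.ConvexBisectionAcyclicBisectionExistsKasSeamQuotient
import Summits.SmoothPoincare4.SmoothPoincare4.Theorems.ConvexBisectionAcyclicBisectionExistsKasSphereOffCore
import Summits.SmoothPoincare4.SmoothPoincare4.Theorems.ConvexBisectionAcyclicBisectionExistsKasTubeSeam
import HarnessLib

/-!
# Kas' seam quotient (D), unconditionally: `H₁(∂X; ℤ) ≅ H₁(∂ Base g ∖ ⋃ Kᵢ; ℤ) ⧸ ⟨longitudes⟩`
(helper for stub `stub_modelsOn_counts` = NF2, clause 3 = Kas' presentation of `H₁(∂X(F; l); ℤ)`;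
line `modp-braid-orbits` r9, crux `ConvexBisection.AcyclicBisectionExists`, item
stmt-SmoothPoincare4-10508; wave 4 / W4-D, design lemma (D) `Kas_seam_quotient` of
`work/stubs/Kas_Design.lean`, verbatim = registered sub-goal stub `stub_Kas_seam_quotient`.)

Assembly only: `Kas_seam_quotient_of` (`…KasSeamQuotient.lean`: the cover `∂X = U ∪ ⋃ Wᵢ`,
`U ∩ Wᵢ ≃ₜ tubeSeam`, Mayer–Vietoris `…KasSeamMV.lean`) fed by the models — the tube seam
`(T ∖ S) ∩ S³ ≅ T² × ℝ` (`Kas_tubeSeam_homology`, `…KasTubeSeam.lean`) and the sphere off the core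
`S³ ∖ S ≅ D² × S¹` (`Kas_sphereOffCore_homology`, `Kas_sphereOffCore_generated`,
`…KasSphereOffCore.lean`), through `ker_and_surjective_of_models`.  Everything is proved; no named
facts, no `sorry`.  References: A. Kas, Pacific J. Math. 89 (1980) [Kas1980]; R. E. Gompf,
A. I. Stipsicz, *4-Manifolds and Kirby Calculus* (1999), §8.2 [GompfStipsicz1999].
-/

noncomputable section

-- the prescribed namespace `Summit.<P>.<Sub>.…` duplicates `SmoothPoincare4` (P = Sub)
set_option linter.dupNamespace false

open scoped Manifold ContDiff Topology
open Set Function Metric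
open Literature.Topology.FourManifolds Literature.Topology.FourManifolds.LefschetzBase
  Literature.AlgebraicTopology.SingularHomology Literature.Topology.FourManifolds.HandleAttachingMap

namespace Summit.SmoothPoincare4.SmoothPoincare4.Theorems.AcyclicBisectionExists.ModpBraidOrbits

section Final

variable {g : ℕ} {l : List ((Fin g ⊕ Fin g → ℤ) × Bool)}
  {h : Fin l.length → HandleAttachingMap 3 2 (Base g)}
  {X : Type} [TopologicalSpace X] [ChartedSpace (EuclideanHalfSpace 4) X]

/-- **(D) `Kas_seam_quotient`.**  For a multi-attachment `X` of 2-handles to `Base g` along attaching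
maps `h` with disjoint ranges and any boundary datum `bX` of `X`:
`H₁(bX.carrier; ℤ) ≃ₗ[ℤ] H₁(seamOff h; ℤ) ⧸ ⟨ℓᵢ⟩` — `Kas_seam_quotient_of` fed by the models
(`Kas_tubeSeam_homology`, `Kas_sphereOffCore_homology`, `Kas_sphereOffCore_generated`). [cite: Kas1980] -/
theorem Kas_seam_quotient (D : MultiAttachmentData h (𝓡∂ 4) X) (bX : BoundaryData (𝓡∂ 4) X (𝓡 3)) :
    Nonempty (singularHomology ℤ ℤ bX.carrier 1 ≃ₗ[ℤ]
      (singularHomology ℤ ℤ ↥(seamOff h) 1 ⧸ Submodule.span ℤ (Set.range (longClass D.disjoint)))) := by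
  obtain ⟨hT1, hT2⟩ := Kas_tubeSeam_homology
  obtain ⟨hS1, hS2, hS3⟩ := Kas_sphereOffCore_homology
  obtain ⟨hM3, hM4⟩ := ker_and_surjective_of_models hT2 hS2 hS3 Kas_sphereOffCore_generated
  exact Kas_seam_quotient_of hT1 hS1 hM3 hM4 D bX

/-- **(D) registered sub-goal stub `stub_Kas_seam_quotient`** of `stub_modelsOn_counts` (design lemma
`Kas_seam_quotient` verbatim): Kas' `H₁(∂X; ℤ) ≅ H₁(∂ Base g ∖ ⋃ Kᵢ; ℤ) ⧸ ⟨longitudes⟩` for the seam of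
a multi-attachment of 2-handles on `Base g`. [cite: Kas1980] -/
theorem stub_Kas_seam_quotient : ∀ (g : ℕ) (l : List ((Fin g ⊕ Fin g → ℤ) × Bool))
    (h : Fin l.length → Literature.Topology.FourManifolds.HandleAttachingMap 3 2
      (Literature.Topology.FourManifolds.LefschetzBase.Base g))
    (X : Type) [TopologicalSpace X] [T2Space X] [SecondCountableTopology X] [CompactSpace X]
    [ChartedSpace (EuclideanHalfSpace 4) X] [IsManifold (𝓡∂ 4) ∞ X]
    (D : Literature.Topology.FourManifolds.HandleAttachingMap.MultiAttachmentData h (𝓡∂ 4) X)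
    (bX : Literature.Topology.FourManifolds.BoundaryData (𝓡∂ 4) X (𝓡 3)),
    Nonempty (Literature.AlgebraicTopology.SingularHomology.singularHomology ℤ ℤ bX.carrier 1 ≃ₗ[ℤ]
      (Literature.AlgebraicTopology.SingularHomology.singularHomology ℤ ℤ ↥(seamOff h) 1 ⧸
        Submodule.span ℤ (Set.range (longClass D.disjoint)))) :=
  fun _ _ _ _ _ _ _ _ _ _ D bX => Kas_seam_quotient D bX

end Final

end Summit.SmoothPoincare4.SmoothPoincare4.Theorems.AcyclicBisectionExists.ModpBraidOrbits

end
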